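import Literature.AlgebraicGeometry.HodgeTheory.HomComplexPullback
import Literature.AlgebraicGeometry.HodgeTheory.HomComplexUnit
import HarnessLib

/-!
# The unit `𝒪[0] ⟶ 𝓗om•(E•, E•)` along a pull-back

Layer `Literature/AlgebraicGeometry/HodgeTheory`; the pull-back twin of `HomComplexUnitPushforward.lean` (which treats `ε_*` for an
ISOMORPHISM of schemes); sequel to `HomComplexUnit.lean` (`HomComplex.unit X E a b : 𝒪_X[0] ⟶ 𝓗om•(E•, E•)`, degree-`0` component
`Σ_{i ∈ [-b,-a]} (sheafHomUnit E^{-i} ≫ ι)`) and `HomComplexPullback.lean` (`homComplexPullbackHom f E L : f^*• 𝓗om•(E•, L•) ⟶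
𝓗om•(f^*• E•, f^*• L•)`, ANY morphism `f`). With `u_f : f^*𝒪_Y ⟶ 𝒪_X` the transpose `f^*(f♯) ≫ ε` of the algebra unit (an isomorphism,
`Modules/PullbackAlgebraUnit`), everything ONE-SIDED (no inverse of the Hom-complex comparison is used or needed):

* `pullback_map_unitSummand_comp` — `f^*(sheafHomUnit E^{-i} ≫ ι) ≫ (homComplexPullbackHom).f 0 = u_f ≫ (sheafHomUnit (f^*E^{-i}) ≫ ι')`
  (summand by summand: `pullback_map_sheafHomUnit_comp_sheafHomPullbackComparison` of `Modules/SheafHomPullback` and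
  `map_ι_comp_homComplexPullbackHom_f`);
* `pullback_map_unitDeg₀_comp` — the degree-`0` unit: `f^*(Σ_i unitSummand_i) ≫ (…).f 0 = u_f ≫ Σ_i unitSummand'_i`;
* **`singleMap_inv_comp_map_unit_comp_homComplexPullbackHom`** — the chain-map form:
  `(f^*𝒪_Y)[0] ≅ f^*•(𝒪_Y[0]) —f^*•(unit E)→ f^*• 𝓗om•(E•,E•) —(…)→ 𝓗om•(f^*•E•, f^*•E•)` equals `u_f[0] ≫ unit (f^*• E•)`
  (Mathlib `singleMapHomologicalComplex`, `from_single_hom_ext`).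

This is step (Q2) (unit compatibility) of the typing plan of the library item (L2) `SigmaPullbackCompat` (crux stmt-HodgeConjecture-26512,
support line «sigma-descent-along-q»: the first arrow `Q(unit)` of the venture HSemireg's `σ_q` along `q^*`); nothing of that crux is
asserted here. Everything is proved; no named facts, no definitions.
References: [BuchweitzFlenner2003] §2, Def. 4.1 and §3 (the unit / trace formalism and its functoriality under base change); [GortzWedhorn2020]
(7.8.3); [StacksProject] Tag 01AK (`f^*𝒪_Y = 𝒪_X`); [Weibel1994] 2.7.4–2.7.5.
-/

noncomputable section

-- `TopCat.Presheaf`/`Scheme.Modules`/`GradedObject` are not reducible.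
set_option backward.isDefEq.respectTransparency false

open CategoryTheory CategoryTheory.Category CategoryTheory.Limits AlgebraicGeometry Opposite

universe u

namespace Literature.AlgebraicGeometry.HodgeTheory

open Literature.AlgebraicGeometry.Modules Literature.Algebra.Homology

variable {X Y : Scheme.{u}} (f : X ⟶ Y) (E : CochainComplex Y.Modules ℤ)

/-- **One unit summand along `f^*`**: `f^*(sheafHomUnit E^{-i} ≫ ι_{-i,i}) ≫ (homComplexPullbackHom).f 0 = (f^*(f♯) ≫ ε) ≫ sheafHomUnit (f^*E^{-i}) ≫ ι'`.
[cite: BuchweitzFlenner2003, §2, Def. 4.1 and §3 (the unit of the trace formalism is compatible with base change)]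
[cite: GortzWedhorn2020, (7.8.3) and Exercise 7.20 (a)] -/
theorem pullback_map_unitSummand_comp (i : ℤ) :
    (Scheme.Modules.pullback f).map (HomComplex.unitSummand Y E i) ≫ (homComplexPullbackHom f E E).f 0 =
      ((Scheme.Modules.pullback f).map (algebraUnit f) ≫
          (Scheme.Modules.pullbackPushforwardAdjunction f).counit.app (unitModule X)) ≫
        HomComplex.unitSummand X (((Scheme.Modules.pullback f).mapHomologicalComplex (ComplexShape.up ℤ)).obj E) i := by
  rw [HomComplex.unitSummand, HomComplex.unitSummand, Functor.map_comp, Category.assoc, map_ι_comp_homComplexPullbackHom_f,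
    ← Category.assoc, pullback_map_sheafHomUnit_comp_sheafHomPullbackComparison, Category.assoc]
  rfl

/-- **The degree-`0` unit along `f^*`**: `f^*(Σ_i unitSummand_i) ≫ (homComplexPullbackHom).f 0 = (f^*(f♯) ≫ ε) ≫ Σ_i unitSummand'_i`.
[cite: BuchweitzFlenner2003, §2, Def. 4.1 and §3 (the unit of the trace formalism is compatible with base change)] -/
theorem pullback_map_unitDeg₀_comp (a b : ℤ) :
    (Scheme.Modules.pullback f).map (HomComplex.unitDeg₀ Y E a b) ≫ (homComplexPullbackHom f E E).f 0 =
      ((Scheme.Modules.pullback f).map (algebraUnit f) ≫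
          (Scheme.Modules.pullbackPushforwardAdjunction f).counit.app (unitModule X)) ≫
        HomComplex.unitDeg₀ X (((Scheme.Modules.pullback f).mapHomologicalComplex (ComplexShape.up ℤ)).obj E) a b := by
  rw [HomComplex.unitDeg₀, HomComplex.unitDeg₀, Functor.map_sum, Preadditive.sum_comp, Preadditive.comp_sum]
  exact Finset.sum_congr rfl fun i _ => pullback_map_unitSummand_comp f E i

variable (a b : ℤ) [E.IsStrictlyGE a] [E.IsStrictlyLE b]

/-- **The unit along a pull-back** (chain-map form, one-sided): the composite
`(f^*𝒪_Y)[0] ≅ f^*•(𝒪_Y[0]) —f^*•(unit E)→ f^*• 𝓗om•(E•,E•) —homComplexPullbackHom→ 𝓗om•(f^*•E•, f^*•E•)` is `(f^*(f♯) ≫ ε)[0] ≫ unit (f^*• E•)`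
(both are morphisms out of a single complex; compare degree-`0` components, `pullback_map_unitDeg₀_comp`).
[cite: BuchweitzFlenner2003, §2, Def. 4.1 and §3 (the unit of the trace formalism is compatible with base change)] [cite: StacksProject, Tag 01AK] -/
theorem singleMap_inv_comp_map_unit_comp_homComplexPullbackHom :
    (HomologicalComplex.singleMapHomologicalComplex (Scheme.Modules.pullback f) (ComplexShape.up ℤ) 0).inv.app (unitModule Y) ≫
        ((Scheme.Modules.pullback f).mapHomologicalComplex (ComplexShape.up ℤ)).map (HomComplex.unit Y E a b) ≫
          homComplexPullbackHom f E E =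
      (HomologicalComplex.single X.Modules (ComplexShape.up ℤ) 0).map
          ((Scheme.Modules.pullback f).map (algebraUnit f) ≫
            (Scheme.Modules.pullbackPushforwardAdjunction f).counit.app (unitModule X)) ≫
        HomComplex.unit X (((Scheme.Modules.pullback f).mapHomologicalComplex (ComplexShape.up ℤ)).obj E) a b := by
  apply HomologicalComplex.from_single_hom_ext
  rw [HomologicalComplex.comp_f, HomologicalComplex.comp_f, HomologicalComplex.comp_f, HomologicalComplex.single_map_f_self,
    HomologicalComplex.singleMapHomologicalComplex_inv_app_self, Functor.mapHomologicalComplex_map_f, HomComplex.unit,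
    HomComplex.unit, HomologicalComplex.mkHomFromSingle_f, HomologicalComplex.mkHomFromSingle_f, Functor.map_comp]
  simp only [Category.assoc]
  rw [pullback_map_unitDeg₀_comp]
  simp only [Category.assoc]
  erw [Iso.inv_hom_id_assoc]
  rw [← (Scheme.Modules.pullback f).map_comp_assoc, Iso.inv_hom_id, CategoryTheory.Functor.map_id, Category.id_comp]

end Literature.AlgebraicGeometry.HodgeTheory

end
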